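import Summits.NavierStokesRegularity.NavierStokesRegularity.Theorems.LevelSetModerationHighSpeedPressureWorkLevelSetIBP
import Summits.NavierStokesRegularity.NavierStokesRegularity.Theorems.LevelSetModerationHighSpeedPressureWorkGivenPressure
import Summits.NavierStokesRegularity.NavierStokesRegularity.Theorems.LevelSetModerationHighSpeedPressureWorkModeratedSplit
import Summits.NavierStokesRegularity.NavierStokesRegularity.Theorems.LevelSetModerationHighSpeedPressureWorkCostCauchySchwarz
import Summits.NavierStokesRegularity.NavierStokesRegularity.Theorems.LevelSetModerationHighSpeedPressureWorkHeadCeiling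
import Summits.NavierStokesRegularity.NavierStokesRegularity.Theorems.LevelSetModerationHighSpeedPressureWorkSliceRegularity

/-!
# Route LevelSetModeration — `HighSpeedPressureWork` from the comoving budget (transfer of line `Sketch`)

Support file for item stmt-NavierStokesRegularity-18149. The lead's skeleton
`Cruxes/HighSpeedPressureWork/Lines/Sketch.lean` proves the crux BY NAME from seven stubs; six of them
(`stub_pressureWorkGivenPressure`, `stub_sliceRegularity`, `stub_levelSetIBP`, `stub_moderatedSplit`,
`stub_headCeiling`, `stub_costCauchySchwarz`) are theorems of the tree (this route's Theorems files, namespace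
`…Theorems`), so the skeleton's composition — reproduced here verbatim with the landed stubs — gives the
TRANSFER `ComovingBudget → HighSpeedPressureWork`, isolating the line's open content in its one remaining
stub `stub_comovingBudget` (a Galilean frame within the budget `c|U| ≤ ½√(F₁M^m)`, a head level and a
continuous tendency majorant whose head-deficit flux is `≤ ½√(F₁M^mV_c(T))√D_c(T)`).
-/

noncomputable section

-- single-conjunct summit: `Summit.<Summit>.<Problem>` repeats the name by the D-0017 layout
set_option linter.dupNamespace false

namespace Summit.NavierStokesRegularity.NavierStokesRegularity.Theorems

open MeasureTheory Set Filter Topology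
open scoped ENNReal
open Literature.Analysis.FluidPDE
open Summit.NavierStokesRegularity.NavierStokesRegularity.Theses.LevelSetModeration

/-- **`HighSpeedPressureWork` from the comoving budget** (transfer of line `Sketch`: the lead's
composition `HighSpeedPressureWork_of` with the six landed infrastructure stubs; the hypothesis is the
registered open stub `stub_comovingBudget` verbatim). [folklore] -/
theorem levelSetModeration_highSpeedPressureWork_of_comovingBudget :
    (∀ (ν T : ℝ), 0 < ν → 0 < T → ∃ m : ℝ, m < 10 / 3 ∧ ∃ F₁ : ℝ → ℝ → ℝ, ∀ (u : ℝ → EuclideanSpace ℝ (Fin 3) → EuclideanSpace ℝ (Fin 3)) (p : ℝ → EuclideanSpace ℝ (Fin 3) → ℝ), Literature.Analysis.FluidPDE.IsClassicalNSSolutionOn (Set.Ico 0 T) ν 0 u p → Literature.Analysis.FluidPDE.IsLerayHopfOn T ν 0 (u 0) u → Literature.Analysis.FluidPDE.HasRapidSpatialDecay (u 0) → ∀ (E₀ B₀ : ℝ), (∫ x, ‖u 0 x‖ ^ 2) ≤ E₀ → (∀ x, ‖u 0 x‖ ≤ B₀) → ∀ (M c t : ℝ), 2 * B₀ ≤ M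 → M / 2 ≤ c → c ≤ M → 0 < c → t ∈ Set.Ico 0 T → ∃ (U : EuclideanSpace ℝ (Fin 3)) (K : ℝ) (r : ℝ → ℝ), Continuous r ∧ 0 ≤ F₁ E₀ B₀ ∧ (∀ x, p 0 x + ‖u 0 x - U‖ ^ 2 / 2 ≤ K) ∧ (∀ τ ∈ Set.Icc 0 t, ∀ x, Literature.Analysis.FluidPDE.timeDerivWithin (Set.Ico 0 T) p τ x + fderiv ℝ (p τ) x U ≤ r τ) ∧ c * ‖U‖ ≤ Real.sqrt (F₁ E₀ B₀ * M ^ m) / 2 ∧ (∫ τ in Set.Ioo 0 t, ∫ x, Set.indicator {x | c < ‖u τ x‖} (fun x => c / ‖u τ x‖ ^ 2 * max (-(fderiv ℝ (fun y => ‖u τ y‖) x (u τ x))) 0 * (K + (∫ σ in Set.Ioo 0 τ, r σ) - (p τ x + ‖u τ x - U‖ ^ 2 / 2))) x) ≤ Real.sqrt (F₁ E₀ B₀ * M ^ m * (∫⁻ τ in Set.Ioo 0 T, volume {x | c < ‖u τ x‖}).toReal) / 2 * Real.sqrt ((∫⁻ τ in Set.Ioo 0 T, ∫⁻ x, Set.indicator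 {x | c < ‖u τ x‖} (fun x => ENNReal.ofReal (‖fderiv ℝ (fun y => ‖u τ y‖) x‖ ^ 2)) x).toReal)) → Summit.NavierStokesRegularity.NavierStokesRegularity.Theses.LevelSetModeration.HighSpeedPressureWork := by
  intro hCB ν T hν hT
  obtain ⟨m, hm, F₁, hF₁⟩ := hCB ν T hν hT
  refine ⟨m, hm, F₁, ?_⟩
  intro u p hcl hLH hdec E₀ B₀ hE hB M c t hM hMc hcM hc ht
  obtain ⟨U, K, r, hr, hF0, hK, htend, hbudget, hdef⟩ :=
    hF₁ u p hcl hLH hdec E₀ B₀ hE hB M c t hM hMc hcM hc ht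
  -- the regularity package and the head ceiling on the slab `[0,t]`
  obtain ⟨hbdd, hB', hintG, hintDef⟩ :=
    stub_sliceRegularity ν T u p hν hT hcl hLH hdec c t U K r hc ht hr
  have hceil := stub_headCeiling ν T u p hν hT hcl hLH hdec U K r t ht hr hK htend hB'
  -- abbreviations for the route's level-set quantities
  set V : ℝ := (∫⁻ τ in Set.Ioo 0 T, volume {x | c < ‖u τ x‖}).toReal with hV
  set D : ℝ := (∫⁻ τ in Set.Ioo 0 T, ∫⁻ x, Set.indicator {x | c < ‖u τ x‖}
      (fun x => ENNReal.ofReal (‖fderiv ℝ (fun y => ‖u τ y‖) x‖ ^ 2)) x).toReal with hD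
  set G : ℝ → ℝ := fun τ => ∫ x, Set.indicator {x | c < ‖u τ x‖}
      (fun x => ‖fderiv ℝ (fun y => ‖u τ y‖) x‖) x with hG
  set Df : ℝ → ℝ := fun τ => ∫ x, Set.indicator {x | c < ‖u τ x‖}
      (fun x => c / ‖u τ x‖ ^ 2 * max (-(fderiv ℝ (fun y => ‖u τ y‖) x (u τ x))) 0 *
        (K + (∫ σ in Set.Ioo 0 τ, r σ) - (p τ x + ‖u τ x - U‖ ^ 2 / 2))) x with hDf
  set J : ℝ → ℝ := fun τ => ∫ x, max (1 - c / ‖u τ x‖) 0 * (fderiv ℝ (p τ) x (u τ x)) with hJ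
  -- signs
  have hB0 : 0 ≤ B₀ := (norm_nonneg _).trans (hB 0)
  have hM0 : 0 ≤ M := by linarith
  have ha : 0 ≤ F₁ E₀ B₀ * M ^ m := mul_nonneg hF0 (Real.rpow_nonneg hM0 m)
  have hsV : 0 ≤ Real.sqrt V := Real.sqrt_nonneg _
  have hsD : 0 ≤ Real.sqrt D := Real.sqrt_nonneg _
  have hRHS : 0 ≤ Real.sqrt (F₁ E₀ B₀ * M ^ m * V) * Real.sqrt D := by positivity
  -- pressure work with the given pressure
  rw [stub_pressureWorkGivenPressure ν T u p hν hT hcl hLH c t ht]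
  change -(∫ τ in Set.Ioo 0 t, J τ) ≤ Real.sqrt (F₁ E₀ B₀ * M ^ m * V) * Real.sqrt D
  by_cases hintJ : IntegrableOn J (Set.Ioo 0 t)
  swap
  · rw [integral_undef hintJ, neg_zero]
    exact hRHS
  -- slice by slice: IBP, moderation, ceiling
  have hpt : ∀ τ ∈ Set.Ioo 0 t, -J τ ≤ Df τ + c * ‖U‖ * G τ := by
    intro τ hτ
    have hτT : τ ∈ Set.Ico 0 T := ⟨hτ.1.le, hτ.2.trans ht.2⟩
    have hτt : τ ∈ Set.Icc 0 t := ⟨hτ.1.le, hτ.2.le⟩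
    have hv : ContDiff ℝ 1 (u τ) := (hcl.contDiff_velocity hτT).of_le (by exact_mod_cast le_top)
    have hq : ContDiff ℝ 1 (p τ) := (hcl.contDiff_pressure hτT).of_le (by exact_mod_cast le_top)
    have hdiv : VectorCalculus.IsDivFree (u τ) := hcl.divFree τ hτT
    have hA : Bornology.IsBounded {x | c < ‖u τ x‖} := hbdd τ hτt
    have h3 := stub_levelSetIBP (u τ) (p τ) c hc hv hq hdiv hA
    have h4 := stub_moderatedSplit (u τ) (p τ) c U (K + ∫ σ in Set.Ioo 0 τ, r σ) hc hv
      hq.continuous hdiv hA (fun x _ => hceil τ hτt x)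
    simp only [hJ, hDf, hG]
    rw [h3]
    exact h4
  have hint2 : IntegrableOn (fun τ => Df τ + c * ‖U‖ * G τ) (Set.Ioo 0 t) :=
    hintDef.add (hintG.const_mul (c * ‖U‖))
  have hmono : ∫ τ in Set.Ioo 0 t, -J τ ≤ ∫ τ in Set.Ioo 0 t, (Df τ + c * ‖U‖ * G τ) :=
    setIntegral_mono_on hintJ.neg hint2 measurableSet_Ioo hpt
  rw [integral_neg] at hmono
  rw [integral_add hintDef (hintG.const_mul (c * ‖U‖)), integral_const_mul] at hmono
  -- the two budgets
  have hCS : (∫ τ in Set.Ioo 0 t, G τ) ≤ Real.sqrt V * Real.sqrt D :=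
    stub_costCauchySchwarz ν T u p hν hT hcl hLH c t hc ht
  have hcU : 0 ≤ c * ‖U‖ := mul_nonneg hc.le (norm_nonneg _)
  have hcost : c * ‖U‖ * ∫ τ in Set.Ioo 0 t, G τ ≤
      Real.sqrt (F₁ E₀ B₀ * M ^ m) / 2 * (Real.sqrt V * Real.sqrt D) :=
    calc c * ‖U‖ * ∫ τ in Set.Ioo 0 t, G τ ≤ c * ‖U‖ * (Real.sqrt V * Real.sqrt D) :=
          mul_le_mul_of_nonneg_left hCS hcU
      _ ≤ Real.sqrt (F₁ E₀ B₀ * M ^ m) / 2 * (Real.sqrt V * Real.sqrt D) :=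
          mul_le_mul_of_nonneg_right hbudget (mul_nonneg hsV hsD)
  have hdef' : (∫ τ in Set.Ioo 0 t, Df τ) ≤
      Real.sqrt (F₁ E₀ B₀ * M ^ m * V) / 2 * Real.sqrt D := hdef
  have hsplit : Real.sqrt (F₁ E₀ B₀ * M ^ m * V) = Real.sqrt (F₁ E₀ B₀ * M ^ m) * Real.sqrt V :=
    Real.sqrt_mul ha V
  calc -(∫ τ in Set.Ioo 0 t, J τ)
        ≤ (∫ τ in Set.Ioo 0 t, Df τ) + c * ‖U‖ * ∫ τ in Set.Ioo 0 t, G τ := hmono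
    _ ≤ Real.sqrt (F₁ E₀ B₀ * M ^ m * V) / 2 * Real.sqrt D +
          Real.sqrt (F₁ E₀ B₀ * M ^ m) / 2 * (Real.sqrt V * Real.sqrt D) := add_le_add hdef' hcost
    _ = Real.sqrt (F₁ E₀ B₀ * M ^ m * V) * Real.sqrt D := by rw [hsplit]; ring


end Summit.NavierStokesRegularity.NavierStokesRegularity.Theorems
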